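import Mathlib
import Summits.Ventures.HodgeRepro.Tier4.Line1.L1Test
import Summits.Ventures.HodgeRepro.Tier4.Line1.RtfGeometric

/-!
# Tier4/Line1/L1GeometricPrep — THE KERNEL SERIES OF AN `L¹` TEST UNDER THE UNIFORM POINCARÉ BOUND: absolute summability
on the torus domains, the kernel as the sum of the partial kernels, the norm domination (steps (a)–(c) of (2)
`RtfGeometricL1`; C-L1-L1RTF Part A, lead (R-9) S14756 / (R-12) S14801)

Blind re-derivation cell `pub-hodge-repro`, Tier 4 (README §9–§10), seat t4-L1-p1 (gen 3).  Target tree path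
`lean/Summits/Ventures/HodgeRepro/Tier4/Line1/L1GeometricPrep.lean`.  Imports this seat's `L1Test` (p699002) and
t4-L1-p2's `RtfGeometric`.  SORRY-FREE; the main theorem (2) with steps (d)–(f) is the successor's plate
(HOME proofs/t4-L1-p1/Tier4/Line1/L1Geometric-PREPARED.lean, NOT proposed).

STATEMENT OF RECORD OF (2) (S14870): for characters `χ χ'` and an `L¹` test `f` whose kernel series is uniformly summable on
compacts (the conclusion of `poincare_uniform_of_conv` for `f = f₁ ⋆ f₂`), the orbital terms are summable and
`J(f) = ∑' o, O_o(f)`.  PROOF PLAN (every lemma below is a step; the `sorry`s are exactly the stuck points):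
(a) `summable_kernel_of_bound`: the kernel series `∑ γ, f (t⁻¹ γ t')` is absolutely summable on `closure DT × closure DT'`
    (the bound `M` applied to the compacts `(↑) '' closure DT`, `(↑) '' closure DT'`);
(b) `hasSum_partialKernel`: `HasSum (fun o => partialKernel o f t t') (kernel f t t')` — `HasSum.tsum_fiberwise` along
    `orbitOf` (the fibre subtype `orbitOf ⁻¹' {o}` is definitionally `{γ // orbitOf γ = o}` of `partialKernel`);
(c) `norm_partialKernel_le` / `tsum_norm_partialKernel_le`: `∑' o, ‖partialKernel o f t t'‖ ≤ ∑' γ, ‖f (t⁻¹ γ t')‖ ≤ M`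
    (`norm_tsum_le_tsum_norm` on each fibre + `tsum_fiberwise` for the norms);
(d) measurability: `t' ↦ partialKernel o f t t'` is (ae-strongly) measurable on `DT'` — a pointwise limit of finite sums of
    continuous functions along the countably generated `atTop` of `Finset Gk` (`[Countable Gk]`; Mathlib:
    `aestronglyMeasurable_of_tendsto_ae` / `measurable_of_tendsto_metrizable'`), or continuity if a uniform M-test is
    available; THE LIKELY STUCK POINT;
(e) `integral_tsum` on `DT'` then on `DT` (`MeasureTheory.integral_tsum`: each term ae-strongly measurable and
    `∑' o, ∫⁻ ‖term o‖ ≠ ∞`, from (c) and `lintegral_tsum` with the bound `M · μT'(DT')` resp. `M · μT(DT) · μT'(DT')`);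
(f) assemble: `J χ χ' f = ∫_{DT} ∫_{DT'} kernel · χ · conj χ' = ∫∫ ∑' o, partialKernel o … = ∑' o, ∫∫ … = ∑' o, orbital o`,
    and `Summable (orbital)` from the finiteness of the `ℒ¹` sum in (e).
`IsTest f` entered p2's `rtf_geometric` only through the FINITE support count (`finite_support_closure`), which the bound
replaces.  0 print.  HC_CM is NOT proved by anyone in this repository.
-/

set_option autoImplicit false

noncomputable section

namespace Summit.Ventures.HodgeRepro.Tier4.Line1

open MeasureTheory Topology

namespace RTF

namespace Setting

variable {G : Type} [Group G] [TopologicalSpace G] [MeasurableSpace G] [hBorel : BorelSpace G]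
variable [IsTopologicalGroup G] (S : Setting G)

/-- **the uniform Poincaré bound on compacts** (the conclusion of `poincare_uniform_of_conv`, as a hypothesis on `f`). -/
def PoincareUniform (f : G → ℂ) : Prop :=
  ∀ C₁ C₂ : Set G, IsCompact C₁ → IsCompact C₂ →
    ∃ M : ℝ, ∀ x ∈ C₁, ∀ y ∈ C₂, Summable (fun γ : S.Gk => ‖f (x⁻¹ * γ * y)‖) ∧
      ∑' γ : S.Gk, ‖f (x⁻¹ * γ * y)‖ ≤ M

/-- (1′) rephrased: the convolution of an `L¹` test with a compactly supported test satisfies the uniform bound. -/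
theorem poincareUniform_conv [LocallyCompactSpace G] {f₁ f₂ : G → ℂ} (hf₁ : IsTestL1 S f₁) (hf₂ : IsTest f₂) :
    PoincareUniform S (S.conv f₁ f₂) :=
  fun _ _ h₁ h₂ => S.poincare_uniform_of_conv hf₁ hf₂ h₁ h₂

omit [IsTopologicalGroup G] hBorel in
/-- (a) on the closures of the torus domains the kernel series is absolutely summable, with a uniform bound `M`. -/
theorem exists_bound_kernel_series {f : G → ℂ} (hP : PoincareUniform S f) :
    ∃ M : ℝ, ∀ t ∈ closure S.DT, ∀ t' ∈ closure S.DT',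
      Summable (fun γ : S.Gk => ‖f ((t : G)⁻¹ * γ * t')‖) ∧ ∑' γ : S.Gk, ‖f ((t : G)⁻¹ * γ * t')‖ ≤ M := by
  obtain ⟨M, hM⟩ := hP ((fun t : S.T => (t : G)) '' closure S.DT) ((fun t : S.T' => (t : G)) '' closure S.DT')
    (S.compT.image continuous_subtype_val) (S.compT'.image continuous_subtype_val)
  exact ⟨M, fun t ht t' ht' => hM _ ⟨t, ht, rfl⟩ _ ⟨t', ht', rfl⟩⟩

omit [IsTopologicalGroup G] hBorel in
/-- (b) the kernel is the sum of the partial kernels, as a `HasSum` over the orbits (regrouping along `orbitOf`). -/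
theorem hasSum_partialKernel {f : G → ℂ} (t : S.T) (t' : S.T')
    (hs : Summable (fun γ : S.Gk => ‖f ((t : G)⁻¹ * γ * t')‖)) :
    HasSum (fun o : S.Orbit => S.partialKernel o f t t') (S.kernel f t t') := by
  have h : HasSum (fun γ : S.Gk => f ((t : G)⁻¹ * γ * t')) (S.kernel f t t') := (hs.of_norm).hasSum
  exact h.tsum_fiberwise S.orbitOf

omit [IsTopologicalGroup G] hBorel in
/-- (c) the norms of the partial kernels are dominated by the kernel series of norms. -/
theorem tsum_norm_partialKernel_le {f : G → ℂ} (t : S.T) (t' : S.T')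
    (hs : Summable (fun γ : S.Gk => ‖f ((t : G)⁻¹ * γ * t')‖)) :
    Summable (fun o : S.Orbit => ‖S.partialKernel o f t t'‖) ∧
      ∑' o : S.Orbit, ‖S.partialKernel o f t t'‖ ≤ ∑' γ : S.Gk, ‖f ((t : G)⁻¹ * γ * t')‖ := by
  -- the fibrewise sums of the norms
  have hb : HasSum (fun o : S.Orbit => ∑' γ : S.orbitOf ⁻¹' {o}, ‖f ((t : G)⁻¹ * γ * t')‖)
      (∑' γ : S.Gk, ‖f ((t : G)⁻¹ * γ * t')‖) := hs.hasSum.tsum_fiberwise S.orbitOf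
  have hle : ∀ o : S.Orbit, ‖S.partialKernel o f t t'‖ ≤ ∑' γ : S.orbitOf ⁻¹' {o}, ‖f ((t : G)⁻¹ * γ * t')‖ := by
    intro o
    unfold partialKernel
    exact norm_tsum_le_tsum_norm (hs.subtype _)
  have hsum : Summable (fun o : S.Orbit => ‖S.partialKernel o f t t'‖) :=
    Summable.of_nonneg_of_le (fun o => norm_nonneg _) hle hb.summable
  refine ⟨hsum, ?_⟩
  calc ∑' o : S.Orbit, ‖S.partialKernel o f t t'‖
      ≤ ∑' o : S.Orbit, ∑' γ : S.orbitOf ⁻¹' {o}, ‖f ((t : G)⁻¹ * γ * t')‖ := hsum.tsum_le_tsum hle hb.summable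
    _ = ∑' γ : S.Gk, ‖f ((t : G)⁻¹ * γ * t')‖ := hb.tsum_eq

end Setting

end RTF

end Summit.Ventures.HodgeRepro.Tier4.Line1

end
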